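import Summits.QuantumFields.YangMills.Theorems.BalabanUVNodesPortS1JacobianHolo
import Summits.QuantumFields.YangMills.Theorems.BalabanUVNodesPortS1PathLetter
import Summits.QuantumFields.YangMills.Theorems.BalabanUVNodesPortS1HalvesJacDefs
import Literature.MathematicalPhysics.QuantumFieldTheory.Balaban1983to89.Node00.MultiScaleFibreChartCurvatureCompact
import Literature.MathematicalPhysics.QuantumFieldTheory.Balaban1983to89.Node00.Record12MinimiserSelection

/-!
# NODE O port PT-A — THE JACOBIAN FACTORS OF `phiLZjac` ON THE GERM AT `B = 0` ARE VALUES OF THE ANALYTIC HOLOMORPHIC FACTOR: under ⁸'s TokE + TokP9-reg shapes, eventually near `B = 0`,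
# every `det A₁(c)(V^{(k)}_{ax}(W_B))` is POSITIVE (letter + continuity along segments + intermediate value theorem from `(N_c∕|I|)³ > 0` at `B = 0`), hence `jacFactorC c` (✓p812392) is ℂ-ANALYTIC at
# `↑V^{(k)}_{ax}(W_B)` with value `jacFactor … B c` (✓p812199) — row (a) of `stub_LZjac` at the record's real points, one torus

Cell `ym-nodeO-ideate`, porter seat `ymgap-nodeO-port-PTA-1` (gen 5); `--supports stmt-QuantumFields-27930` (helper; registered stub `stub_LZjac` of the reshaped skeleton `pta_residueW`, PORT-PLAN-v5 §4).
[I] = [Balaban1987RG1], [15] = [Balaban1985Variational], [B7] = [Balaban1985Averaging].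
CONSUMED BY NAME, nothing modified: ✓p812449 `…JacobianHolo` (`analyticAt_jacFactorC_coeField`, `jacFactorC_coeField`), ✓p811962 `…PathLetter` (`eventually_portVkAx_eq_axialize_iter`, `continuousAt_iter_recordBgField`,
`eventually_small_portVkAx`, `eventually_recordB0BlockInvertible_portVkAx`), ✓p811778 (`recordLQt_apply_eq_fderiv_avgM`), ✓p810869 (`recordLQtB0_one`), ✓p811030 (`portVkAx_zero`), ✓p809706
(`det_recordLQtB0_eq_prod`), ✓p798206 (`continuousAt_recordBgField_of_analyticAt`, `recordBgField_zero`); N07's `N07DirectMethod.continuousAt_iter_avOfRecord_of_plaqSmall`,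
`N07CritCfgAxOfRecordClauses.continuousAt_axialize_contourOfRecord_of_plaqSmall`, `N07AveragingLocalSmooth.contDiffAt_avgM_apply`, `N07AveragingLocalContinuity.continuousAt_avgFun_apply_of_small`;
NODE 00's `continuous_coeField_SU`, `isOpen_small`, `isOpen_plaqSmall`, `iter_avOfRecord_one`; Mathlib's `ContDiffAt.continuousAt_fderiv`, `ContinuousAt.clm_apply`, `intermediate_value_Icc'`.
* §1 CONTINUITY IN THE BACKGROUND at backgrounds in the guard: `eventually_small_nhds`, ★★ `continuousAt_recordLQt_apply`, ★ `continuousAt_recordLQtB0_apply`, ★ `continuousAt_det_b0Block`,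
  `det_b0Block_one_pos` (`det A₁(c)(1) = (N_c∕|I|)³ > 0`); helpers `continuous_matA_apply`, `continuous_su2Coord_apply`.
* §2 ALONG THE PATH: `eventually_continuousAt_recordBgField`, ★ `eventually_continuousAt_axialize_iter_recordBgField` (continuity of `B ↦ axialize(Ū^k(U_{k+1}(W_B)))` at EVERY point near `0`),
  ★★★ `eventually_det_b0Block_portVkAx_pos`.
* §3 ★★★ `eventually_jacFactorC_portVkAx` (analytic AND equal to the real factor, on the germ).

HONEST FRAMING.  Topology ∕ calculus over the tree's own theorems; the two token SHAPES are hypotheses (conjuncts of ⁸'s antecedent, not discharged); NOTHING of Bałaban's estimates asserted, ported or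
discharged; this is row (a) at the REAL points of the germ for ONE torus — analyticity on the whole complex domain (1.11)–(1.16) of `recordUc`, the bound (b), rows (c)(d) in the complex model and the
packaging (e) remain (PORT-PLAN-v5 §4); `stub_LZjac` OPEN; `stub_LZdet` BLOCKED-ON P0 (α)+(β); `stub_FE` XXL; 27930 OPEN · no claim; K0⁷∕K-Ax OPEN; NODE O 0∕1; COUNT 8∕28 · K 1∕4 UNMOVED; finite
`𝕋⁴_{L^K}` at fixed ε — NOT continuum ∕ OS ∕ Clay; **the Yang–Mills mass gap is NOT proved by any of this.**  No `sorry`, no `def`, no `instance`, no `notation`; standard axioms.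
-/

noncomputable section

open scoped BigOperators Matrix.Norms.L2Operator Topology

namespace Summit.QuantumFields.YangMills.Theorems.BalabanUVNodesPortS1

open Summit.QuantumFields.YangMills.Theorems.K0RecordFormatNames
open Summit.QuantumFields.YangMills.BalabanUVNodes
open Literature.MathematicalPhysics.QuantumFieldTheory.Balaban1983to89
open Literature.MathematicalPhysics.QuantumFieldTheory.Balaban1983to89.Node00
open Literature.MathematicalPhysics.QuantumFieldTheory.Balaban1983to89.T4Continuum (T4Family)
open Literature.MathematicalPhysics.QuantumFieldTheory.Balaban1983to89.BlockAveraging (avgFun loopHol Small Idx)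
open Literature.MathematicalPhysics.QuantumFieldTheory.Balaban1983to89.BlockAveragingHaarAC (centralBond)
open Literature.MathematicalPhysics.QuantumFieldTheory.Balaban1983to89.ExpMeanLog (expMeanLogSU)
open Literature.MathematicalPhysics.QuantumFieldTheory.Balaban1983to89.B15AveragingHolomorphic (avgMh coe_avgFun_eq_avgMh)
open Literature.MathematicalPhysics.QuantumFieldTheory.Balaban1983to89.BlockAxialRepresentative (axialize)
open _root_.Matrix _root_.Filter

variable (F : T4Family)

/-! ## §1  Continuity of `LQ̃`, of the `b₀`-blocks and of their determinants IN THE BACKGROUND at small backgrounds -/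

/-- Matrix entries are continuous (a linear map on a finite-dimensional space). [folklore] -/
theorem continuous_matA_apply (a b : Fin 2) : Continuous (fun M : MatA 2 => M a b) :=
  (LinearMap.toContinuousLinearMap (Matrix.entryLinearMap ℂ ℂ a b)).continuous

/-- `su2Coord_j` is continuous. [folklore] -/
theorem continuous_su2Coord_apply (j : Fin 3) : Continuous (fun M : MatA 2 => su2Coord M j) := by
  fin_cases j
  · exact Complex.continuous_im.comp (continuous_matA_apply 0 1)
  · exact Complex.continuous_re.comp (continuous_matA_apply 0 1)
  · exact Complex.continuous_im.comp (continuous_matA_apply 0 0)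

/-- The guard at every coarse bond persists near a background in the guard (finitely many open conditions). [cite: Balaban1987RG1, (0.4) p.253 (bookkeeping)] -/
theorem eventually_small_nhds (k K : ℕ) {V₀ : GaugeField (F.P K) k (SU 2)} (hs : ∀ c : PBond (F.P K) (k + 1), Small expMeanLogSU V₀ c) :
    ∀ᶠ V in 𝓝 V₀, ∀ c : PBond (F.P K) (k + 1), Small expMeanLogSU V c :=
  Filter.eventually_all.2 fun c => (isOpen_small (N := 2) c).mem_nhds (hs c)

/-- ★★ **`V ↦ (LQ̃(V) x)(c)` IS CONTINUOUS AT EVERY BACKGROUND IN THE GUARD** (the response of the `C^ω` (0.4) model is continuous in the base field; `Ū(c)` is continuous; ✓p811778's identification holds on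
the open guard). [cite: Balaban1987RG1, p.267–268 («C is the operator determined by the configuration V^{(k)}»), (0.4) p.253] -/
theorem continuousAt_recordLQt_apply (k K : ℕ) (hk : k + 1 ≤ (F.P K).m + (F.P K).K) {V₀ : GaugeField (F.P K) k (SU 2)}
    (hs : ∀ c : PBond (F.P K) (k + 1), Small expMeanLogSU V₀ c) (x : FluctIdx F k K → ℝ) (c : PBond (F.P K) (k + 1)) :
    ContinuousAt (fun V : GaugeField (F.P K) k (SU 2) => recordLQt F k K V x c) V₀ := by
  -- the explicit form on the guard
  set G : GaugeField (F.P K) k (SU 2) → MatA 2 := fun V =>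
    fderiv ℝ (fun W : PBond (F.P K) k → MatA 2 => avgM W c) (coeField V) (fun b => fluctMat F k K x b * ((V b : SU 2) : MatA 2)) *
      star (((avgFun expMeanLogSU V c : SU 2) : MatA 2)) with hG
  have heq : (fun V : GaugeField (F.P K) k (SU 2) => recordLQt F k K V x c) =ᶠ[𝓝 V₀] G :=
    (eventually_small_nhds F k K hs).mono fun V hV => recordLQt_apply_eq_fderiv_avgM F k K hk V hV x c
  refine ContinuousAt.congr ?_ heq.symm
  -- continuity of the explicit form
  have hcoe : Continuous (coeField : GaugeField (F.P K) k (SU 2) → PBond (F.P K) k → MatA 2) := continuous_coeField_SU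
  have hD : ContinuousAt (fun W : PBond (F.P K) k → MatA 2 => fderiv ℝ (fun W' : PBond (F.P K) k → MatA 2 => avgM W' c) W) (coeField V₀) :=
    (N07AveragingLocalSmooth.contDiffAt_avgM_apply (n := ⊤) c fun i => norm_loopM_coeField_sub_one_lt_one V₀ c (hs c) i).continuousAt_fderiv (by simp)
  have hD' : ContinuousAt (fun V : GaugeField (F.P K) k (SU 2) => fderiv ℝ (fun W' : PBond (F.P K) k → MatA 2 => avgM W' c) (coeField V)) V₀ :=
    hD.comp hcoe.continuousAt
  have hdir : Continuous (fun V : GaugeField (F.P K) k (SU 2) => fun b => fluctMat F k K x b * ((V b : SU 2) : MatA 2)) :=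
    continuous_pi fun b => continuous_const.mul ((continuous_apply b).comp hcoe)
  have happ : ContinuousAt (fun V : GaugeField (F.P K) k (SU 2) =>
      fderiv ℝ (fun W' : PBond (F.P K) k → MatA 2 => avgM W' c) (coeField V) (fun b => fluctMat F k K x b * ((V b : SU 2) : MatA 2))) V₀ :=
    hD'.clm_apply hdir.continuousAt
  have havg : ContinuousAt (fun V : GaugeField (F.P K) k (SU 2) => star (((avgFun expMeanLogSU V c : SU 2) : MatA 2))) V₀ :=
    (continuous_subtype_val.continuousAt.comp (N07AveragingLocalContinuity.continuousAt_avgFun_apply_of_small c (hs c))).star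
  exact happ.mul havg

open Classical in
/-- ★ **THE `b₀`-BLOCK ENTRIES ARE CONTINUOUS IN THE BACKGROUND** at every background in the guard. [cite: Balaban1987RG1, p.267 («h(c)»)] -/
theorem continuousAt_recordLQtB0_apply (k K : ℕ) (hk : k + 1 ≤ (F.P K).m + (F.P K).K) {V₀ : GaugeField (F.P K) k (SU 2)}
    (hs : ∀ c : PBond (F.P K) (k + 1), Small expMeanLogSU V₀ c) (c : PBond (F.P K) (k + 1)) (j a : Fin 3) :
    ContinuousAt (fun V : GaugeField (F.P K) k (SU 2) => recordLQtB0 F k K V (c, j) (c, a)) V₀ :=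
  (continuous_su2Coord_apply j).continuousAt.comp (continuousAt_recordLQt_apply F k K hk hs (Pi.single (recordB0 F k K c, a) (1 : ℝ)) c)

open Classical in
/-- ★ **`det A₁(c)(V)` IS CONTINUOUS IN THE BACKGROUND** at every background in the guard. [cite: Balaban1987RG1, p.268] -/
theorem continuousAt_det_b0Block (k K : ℕ) (hk : k + 1 ≤ (F.P K).m + (F.P K).K) {V₀ : GaugeField (F.P K) k (SU 2)}
    (hs : ∀ c : PBond (F.P K) (k + 1), Small expMeanLogSU V₀ c) (c : PBond (F.P K) (k + 1)) :
    ContinuousAt (fun V : GaugeField (F.P K) k (SU 2) => (Matrix.of fun j j' : Fin 3 => recordLQtB0 F k K V (c, j) (c, j')).det) V₀ := by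
  have he : ∀ j a : Fin 3, ContinuousAt (fun V : GaugeField (F.P K) k (SU 2) => recordLQtB0 F k K V (c, j) (c, a)) V₀ :=
    fun j a => continuousAt_recordLQtB0_apply F k K hk hs c j a
  simp only [Matrix.det_fin_three, Matrix.of_apply]
  exact ((((((he 0 0).mul (he 1 1)).mul (he 2 2)).sub (((he 0 0).mul (he 1 2)).mul (he 2 1))).sub (((he 0 1).mul (he 1 0)).mul (he 2 2))).add
    (((he 0 1).mul (he 1 2)).mul (he 2 0))).add (((he 0 2).mul (he 1 0)).mul (he 2 1)) |>.sub (((he 0 2).mul (he 1 1)).mul (he 2 0))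

open Classical in
/-- At the flat background `det A₁(c)(1) = (N_c∕|I|)³ > 0`. [cite: Balaban1987RG1, p.267 («h(c)»)] -/
theorem det_b0Block_one_pos (k K : ℕ) (hk : k + 1 ≤ (F.P K).m + (F.P K).K) (c : PBond (F.P K) (k + 1)) :
    0 < (Matrix.of fun j j' : Fin 3 => recordLQtB0 F k K (1 : GaugeField (F.P K) k (SU 2)) (c, j) (c, j')).det := by
  have hρ : (0 : ℝ) < ((BlockAveragingHaarAC.nCentral c : ℝ)) / (Fintype.card (Idx (F.P K)) : ℝ) :=
    div_pos (by exact_mod_cast BlockAveragingHaarAC.nCentral_pos c) (by exact_mod_cast Fintype.card_pos)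
  have hblock : (Matrix.of fun j j' : Fin 3 => recordLQtB0 F k K (1 : GaugeField (F.P K) k (SU 2)) (c, j) (c, j')) =
      (((BlockAveragingHaarAC.nCentral c : ℝ)) / (Fintype.card (Idx (F.P K)) : ℝ)) • (1 : Matrix (Fin 3) (Fin 3) ℝ) := by
    ext j j'
    rw [Matrix.of_apply, recordLQtB0_one F k K hk c j j', Matrix.smul_apply, Matrix.one_apply, smul_eq_mul, mul_ite, mul_one, mul_zero]
  rw [hblock, Matrix.det_smul, Matrix.det_one, mul_one, Fintype.card_fin]
  positivity

/-! ## §2  Along the record's path: continuity of `B ↦ V^{(k)}_{ax}(W_B)` NEAR `0`, and positivity of the Jacobian determinants on the germ -/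

/-- The rooted background is continuous AT EVERY POINT NEAR `0` under the TokP9-reg shape (an analytic germ is analytic, hence continuous, on a neighbourhood).
[cite: Balaban1985Variational, Prop. 9 p.309] -/
theorem eventually_continuousAt_recordBgField (θ : Stage13Params F 2) (k K : ℕ)
    (hP9 : letI := θ.instVβ₁; letI := θ.instVβ₂
      AnalyticAt ℝ (fun B : Fin (F.P K).d → Site (F.P K) (k + 1) → θ.Vβ => fun (b : PBond (F.P K) 0) (i i' : Fin 2) =>
        ((recordBgField F θ k K B b : SU 2) : Matrix (Fin 2) (Fin 2) ℂ) i i') 0) :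
    letI := θ.instVβ₁; letI := θ.instVβ₂
    ∀ᶠ B in 𝓝 (0 : Fin (F.P K).d → Site (F.P K) (k + 1) → θ.Vβ),
      ContinuousAt (fun B' : Fin (F.P K).d → Site (F.P K) (k + 1) → θ.Vβ => recordBgField F θ k K B') B := by
  letI := θ.instVβ₁; letI := θ.instVβ₂
  filter_upwards [hP9.eventually_analyticAt] with B hB
  refine continuousAt_pi.2 fun b => ?_
  exact (Topology.IsInducing.subtypeVal.continuousAt_iff).2 ((continuous_apply b).continuousAt.comp hB.continuousAt)

/-- ★ **`B ↦ axialize(Ū^k(U_{k+1}(W_B)))` IS CONTINUOUS AT EVERY POINT NEAR `0`** under the TokP9-reg shape (the rooted background is continuous near `0` and tends to `1`; `Ū^k` is continuous at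
(52)-small fields and `axialize` at small-plaquette fields — N07's direct-method and axial-letter roads). [cite: Balaban1987RG1, (2.3) p.265, (0.4) p.253; Balaban1985Averaging, Prop. 2 p.26] -/
theorem eventually_continuousAt_axialize_iter_recordBgField (θ : Stage13Params F 2) {k K : ℕ} (hk : k + 1 ≤ (F.P K).m + (F.P K).K)
    (hP9 : letI := θ.instVβ₁; letI := θ.instVβ₂
      AnalyticAt ℝ (fun B : Fin (F.P K).d → Site (F.P K) (k + 1) → θ.Vβ => fun (b : PBond (F.P K) 0) (i i' : Fin 2) =>
        ((recordBgField F θ k K B b : SU 2) : Matrix (Fin 2) (Fin 2) ℂ) i i') 0) :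
    letI := θ.instVβ₁; letI := θ.instVβ₂
    ∀ᶠ B in 𝓝 (0 : Fin (F.P K).d → Site (F.P K) (k + 1) → θ.Vβ),
      ContinuousAt (fun B' : Fin (F.P K).d → Site (F.P K) (k + 1) → θ.Vβ =>
        axialize (contourOfRecord F 2 K k) (Averaging.iter (avOfRecord F 2 K) k (recordBgField F θ k K B'))) B := by
  letI := θ.instVβ₁; letI := θ.instVβ₂
  -- admissible radii for N07's two continuity roads
  set C : ℝ := 143 * (((((F.P K).d + 4 : ℕ) : ℝ)) ^ 2 / 4) ^ 2 with hC
  set D : ℝ := ((((F.P K).d + 4) * (F.P K).L : ℕ) : ℝ) ^ 2 with hD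
  have hCpos : 0 < C := by
    have : (0 : ℝ) < ((((F.P K).d + 4 : ℕ) : ℝ)) := by positivity
    positivity
  have hDpos : 0 < D := by
    have hL : (0 : ℝ) < (((F.P K).d + 4) * (F.P K).L : ℕ) := by have := (F.P K).L_pos; positivity
    positivity
  have hδ := ExpMeanLog.deltaSU_pos (n := Fin 2)
  set α₀ : ℝ := min (1 / (3 * C)) (ExpMeanLog.deltaSU (Fin 2) / D) with hα₀
  have hα : 0 < α₀ := lt_min (by positivity) (by positivity)
  have hα3 : C * α₀ ≤ 1 / 3 := by
    have h1 : α₀ ≤ 1 / (3 * C) := min_le_left _ _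
    calc C * α₀ ≤ C * (1 / (3 * C)) := by gcongr
      _ = 1 / 3 := by field_simp
  have hα2 : 2 * α₀ ≤ 2 * ExpMeanLog.deltaSU (Fin 2) / D := by
    have h1 : α₀ ≤ ExpMeanLog.deltaSU (Fin 2) / D := min_le_right _ _
    rw [mul_div_assoc]; linarith
  have hη : 0 < (F.P K).eta k := by
    have hL : (0 : ℝ) < (F.P K).L := by exact_mod_cast (F.P K).L_pos
    unfold Params.eta; positivity
  -- the Federbush radius for `axialize`
  set E : ℝ := ((((F.P K).d * (F.P K).L : ℕ) : ℝ)) ^ 2 / 4 with hE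
  have hE0 : 0 ≤ E := by positivity
  have hFed := FederbushMean.deltaFed_pos (n := Fin 2)
  set a : ℝ := FederbushMean.deltaFed (Fin 2) / (2 * (E + 1)) with ha
  have hapos : 0 < a := by positivity
  have hnum : E * a < FederbushMean.deltaFed (Fin 2) := by
    have h1 : E * a ≤ (E + 1) * a := by nlinarith
    have h2 : (E + 1) * a = FederbushMean.deltaFed (Fin 2) / 2 := by rw [ha]; field_simp
    linarith
  -- (i) the rooted background is (52)-small and `Ū^k` of it is `a`-small, eventually
  have hbg0 : ContinuousAt (fun B : Fin (F.P K).d → Site (F.P K) (k + 1) → θ.Vβ => recordBgField F θ k K B) 0 := by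
    refine continuousAt_pi.2 fun b => ?_
    exact (Topology.IsInducing.subtypeVal.continuousAt_iff).2 (continuousAt_recordBgField_of_analyticAt F θ k K hP9 b)
  have h0 : recordBgField F θ k K (0 : Fin (F.P K).d → Site (F.P K) (k + 1) → θ.Vβ) = 1 := recordBgField_zero F θ hk
  have hev52 : ∀ᶠ B in 𝓝 (0 : Fin (F.P K).d → Site (F.P K) (k + 1) → θ.Vβ), PlaqSmall (α₀ * (F.P K).eta k ^ 2) (recordBgField F θ k K B) := by
    have h1 : PlaqSmall (α₀ * (F.P K).eta k ^ 2) (recordBgField F θ k K (0 : Fin (F.P K).d → Site (F.P K) (k + 1) → θ.Vβ)) := by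
      rw [h0]; intro p; rw [B15Chi124DetSets.plaqHol_one, GaugeGroup.dist1_one]; positivity
    exact hbg0.preimage_mem_nhds ((isOpen_plaqSmall _).mem_nhds h1)
  have hiter0 := continuousAt_iter_recordBgField F θ hk hP9
  have hit0 : Averaging.iter (avOfRecord F 2 K) k (recordBgField F θ k K (0 : Fin (F.P K).d → Site (F.P K) (k + 1) → θ.Vβ)) = 1 := by
    rw [h0]; exact B15Claim189UnitTestAtRecord.iter_avOfRecord_one F 2 K k
  have heva : ∀ᶠ B in 𝓝 (0 : Fin (F.P K).d → Site (F.P K) (k + 1) → θ.Vβ), PlaqSmall a (Averaging.iter (avOfRecord F 2 K) k (recordBgField F θ k K B)) := by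
    have h1 : PlaqSmall a (Averaging.iter (avOfRecord F 2 K) k (recordBgField F θ k K (0 : Fin (F.P K).d → Site (F.P K) (k + 1) → θ.Vβ))) := by
      rw [hit0]; intro p; rw [B15Chi124DetSets.plaqHol_one, GaugeGroup.dist1_one]; exact hapos
    exact hiter0.preimage_mem_nhds ((isOpen_plaqSmall _).mem_nhds h1)
  -- (ii) assemble the three continuities at every nearby point
  filter_upwards [eventually_continuousAt_recordBgField F θ k K hP9, hev52, heva] with B hbg h52 hsa
  have hiter : ContinuousAt (Averaging.iter (avOfRecord F 2 K) k) (recordBgField F θ k K B) :=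
    N07DirectMethod.continuousAt_iter_avOfRecord_of_plaqSmall (N := 2) K k hα hα3 hα2 h52 k le_rfl
  have hax : ContinuousAt (axialize (contourOfRecord F 2 K k)) (Averaging.iter (avOfRecord F 2 K) k (recordBgField F θ k K B)) :=
    N07CritCfgAxOfRecordClauses.continuousAt_axialize_contourOfRecord_of_plaqSmall (N := 2) hk hapos.le (by rw [← hE]; exact hnum) hsa
  have h2 : ContinuousAt (fun B' : Fin (F.P K).d → Site (F.P K) (k + 1) → θ.Vβ => Averaging.iter (avOfRecord F 2 K) k (recordBgField F θ k K B')) B :=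
    hiter.comp hbg
  exact ContinuousAt.comp (g := axialize (contourOfRecord F 2 K k)) hax h2

open Classical in
/-- ★★★ **ON THE GERM AT `B = 0` EVERY JACOBIAN DETERMINANT `det A₁(c)(V^{(k)}_{ax}(W_B))` IS POSITIVE** (TokE + TokP9-reg shapes, standing range): on a ball around `0` the determinant never vanishes
(the letter, ✓p811962), is continuous along every segment `t ↦ tB` (§1 + continuity of the path near `0`), and is `(N_c∕|I|)³ > 0` at `B = 0` — so it is positive by the intermediate value theorem.
[cite: Balaban1987RG1, p.267–268, (2.3) p.265; Balaban1985Variational, Thm 1 p.279, Prop. 9 p.309] -/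
theorem eventually_det_b0Block_portVkAx_pos (a₀ ε₂₉ : ℝ) {k K : ℕ} (hk : k + 1 ≤ (F.P K).m + (F.P K).K) {ε₁ : ℝ} (hε₁ : 0 < ε₁)
    (hTokE : ∀ V : GaugeField (F.P K) (k + 1) (SU 2), PlaqSmall ε₁ V → UkExists F 2 K (k + 1) a₀ V ∧ UniqueUkOrbit F 2 K (k + 1) a₀ V)
    (hP9 : letI θ := thetaFill F a₀ ε₂₉; letI := θ.instVβ₁; letI := θ.instVβ₂
      AnalyticAt ℝ (fun B : recordW F a₀ ε₂₉ k K => fun (b : PBond (F.P K) 0) (i i' : Fin 2) =>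
        ((recordBgField F θ k K B b : SU 2) : Matrix (Fin 2) (Fin 2) ℂ) i i') 0) :
    letI θ := thetaFill F a₀ ε₂₉; letI := θ.instVβ₁; letI := θ.instVβ₂
    ∀ᶠ B in 𝓝 (0 : recordW F a₀ ε₂₉ k K), ∀ c : PBond (F.P K) (k + 1),
      0 < (Matrix.of fun j j' : Fin 3 => recordLQtB0 F k K (portVkAx F a₀ ε₂₉ k K B) (c, j) (c, j')).det := by
  letI θ := thetaFill F a₀ ε₂₉; letI := θ.instVβ₁; letI := θ.instVβ₂
  have hAx := eventually_portVkAx_eq_axialize_iter F a₀ ε₂₉ hk hε₁ hTokE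
  have hcont := eventually_continuousAt_axialize_iter_recordBgField F θ hk hP9
  have hsmall := eventually_small_portVkAx F a₀ ε₂₉ hk hε₁ hTokE hP9
  have hletter := eventually_recordB0BlockInvertible_portVkAx F a₀ ε₂₉ hk hε₁ hTokE hP9
  obtain ⟨r, hr, hball⟩ := Metric.eventually_nhds_iff_ball.1 (hAx.and (hcont.and (hsmall.and hletter)))
  refine Metric.eventually_nhds_iff_ball.2 ⟨r, hr, fun B hB c => ?_⟩
  -- names
  set Ax : recordW F a₀ ε₂₉ k K → GaugeField (F.P K) k (SU 2) := fun B' =>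
    axialize (contourOfRecord F 2 K k) (Averaging.iter (avOfRecord F 2 K) k (recordBgField F θ k K B')) with hAxdef
  set f : GaugeField (F.P K) k (SU 2) → ℝ := fun V => (Matrix.of fun j j' : Fin 3 => recordLQtB0 F k K V (c, j) (c, j')).det with hfdef
  set g : ℝ → ℝ := fun t => f (portVkAx F a₀ ε₂₉ k K (t • B)) with hgdef
  have hBr : ‖B‖ < r := by simpa [Metric.mem_ball, dist_zero_right] using hB
  have hseg : ∀ t ∈ Set.Icc (0 : ℝ) 1, t • B ∈ Metric.ball (0 : recordW F a₀ ε₂₉ k K) r := by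
    intro t ht
    rw [Metric.mem_ball, dist_zero_right, norm_smul, Real.norm_of_nonneg ht.1]
    calc t * ‖B‖ ≤ 1 * ‖B‖ := by gcongr; exact ht.2
      _ < r := by rw [one_mul]; exact hBr
  -- `g` never vanishes on `[0, 1]`
  have hne : ∀ t ∈ Set.Icc (0 : ℝ) 1, g t ≠ 0 := by
    intro t ht
    obtain ⟨-, -, -, hL⟩ := hball _ (hseg t ht)
    have h := hL.ne_zero
    rw [det_recordLQtB0_eq_prod F k K hk] at h
    exact (Finset.prod_ne_zero_iff.1 h) c (Finset.mem_univ c)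
  -- `g` is continuous on `[0, 1]`
  have hline : Continuous fun t' : ℝ => t' • B := continuous_id.smul continuous_const
  have hcont_g : ContinuousOn g (Set.Icc (0 : ℝ) 1) := by
    intro t ht
    obtain ⟨hAxt, hct, hst, -⟩ := hball _ (hseg t ht)
    have hev : (fun t' : ℝ => f (Ax (t' • B))) =ᶠ[𝓝 t] g := by
      have hin : ∀ᶠ t' in 𝓝 t, t' • B ∈ Metric.ball (0 : recordW F a₀ ε₂₉ k K) r :=
        hline.continuousAt.preimage_mem_nhds (Metric.isOpen_ball.mem_nhds (hseg t ht))
      exact hin.mono fun t' ht' => by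
        show f (Ax (t' • B)) = f (portVkAx F a₀ ε₂₉ k K (t' • B))
        rw [(hball _ ht').1]
    have h1 : ContinuousAt (fun t' : ℝ => Ax (t' • B)) t := ContinuousAt.comp (g := Ax) hct hline.continuousAt
    have h2 : ContinuousAt f (Ax (t • B)) := by
      have h := continuousAt_det_b0Block F k K hk hst c
      rw [hAxt] at h
      exact h
    have h3 : ContinuousAt (fun t' : ℝ => f (Ax (t' • B))) t := ContinuousAt.comp (g := f) h2 h1
    exact (h3.congr hev).continuousWithinAt
  -- `g 0 > 0`
  have g0 : 0 < g 0 := by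
    show 0 < f (portVkAx F a₀ ε₂₉ k K ((0 : ℝ) • B))
    rw [zero_smul, portVkAx_zero F a₀ ε₂₉ k K hk]
    exact det_b0Block_one_pos F k K hk c
  -- conclude by the intermediate value theorem
  by_contra hle
  rw [not_lt] at hle
  have hg1 : g 1 ≤ 0 := by
    show f (portVkAx F a₀ ε₂₉ k K ((1 : ℝ) • B)) ≤ 0
    rw [one_smul]; exact hle
  obtain ⟨t, ht, hgt⟩ := intermediate_value_Icc' (zero_le_one : (0 : ℝ) ≤ 1) hcont_g ⟨hg1, g0.le⟩
  exact hne t ht hgt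

/-! ## §3  ★★★ The Jacobian factors of `phiLZjac` are values of the ANALYTIC holomorphic factor on the germ -/

open Classical in
/-- ★★★ **ROW (a) FOR `phiLZjac` ON THE GERM, AT THE REAL POINTS**: under ⁸'s TokE + TokP9-reg shapes, eventually near `B = 0`, for every coarse bond `c`, the holomorphic Jacobian factor
`jacFactorC c` (✓ `…JacobianHoloDefs`) is ℂ-ANALYTIC at `↑V^{(k)}_{ax}(W_B)` and its value there is the Jacobian factor `jacFactor … B c` of `phiLZjac` (✓p812199).
[cite: Balaban1987RG1, (1.18) p.263 («analytic functions»), p.268, (2.3) p.265; Balaban1985Variational, Thm 1 p.279, Prop. 9 p.309] -/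
theorem eventually_jacFactorC_portVkAx (a₀ ε₂₉ : ℝ) {k K : ℕ} (hk : k + 1 ≤ (F.P K).m + (F.P K).K) {ε₁ : ℝ} (hε₁ : 0 < ε₁)
    (hTokE : ∀ V : GaugeField (F.P K) (k + 1) (SU 2), PlaqSmall ε₁ V → UkExists F 2 K (k + 1) a₀ V ∧ UniqueUkOrbit F 2 K (k + 1) a₀ V)
    (hP9 : letI θ := thetaFill F a₀ ε₂₉; letI := θ.instVβ₁; letI := θ.instVβ₂
      AnalyticAt ℝ (fun B : recordW F a₀ ε₂₉ k K => fun (b : PBond (F.P K) 0) (i i' : Fin 2) =>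
        ((recordBgField F θ k K B b : SU 2) : Matrix (Fin 2) (Fin 2) ℂ) i i') 0) :
    letI θ := thetaFill F a₀ ε₂₉; letI := θ.instVβ₁; letI := θ.instVβ₂
    ∀ᶠ B in 𝓝 (0 : recordW F a₀ ε₂₉ k K), ∀ c : PBond (F.P K) (k + 1),
      AnalyticAt ℂ (jacFactorC c : (PBond (F.P K) k → MatA 2) → ℂ) (coeField (portVkAx F a₀ ε₂₉ k K B)) ∧
        jacFactorC c (coeField (portVkAx F a₀ ε₂₉ k K B)) = ((jacFactor F a₀ ε₂₉ k K B c : ℝ) : ℂ) := by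
  letI θ := thetaFill F a₀ ε₂₉; letI := θ.instVβ₁; letI := θ.instVβ₂
  filter_upwards [eventually_small_portVkAx F a₀ ε₂₉ hk hε₁ hTokE hP9, eventually_det_b0Block_portVkAx_pos F a₀ ε₂₉ hk hε₁ hTokE hP9] with B hs hpos c
  exact ⟨analyticAt_jacFactorC_coeField F k K hk _ hs c (hpos c), jacFactorC_coeField F k K hk _ hs c (hpos c)⟩

end Summit.QuantumFields.YangMills.Theorems.BalabanUVNodesPortS1

end
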